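import Summits.MatrixMultiplication.MatrixMultiplication.Theorems.SoloInformedTwistedMatchingsBinomial
import Summits.MatrixMultiplication.MatrixMultiplication.Theorems.SoloInformedTranslationSchemes
import HarnessLib

/-!
# Theorem B‴, effective constants: exponent-`4`, `8`, `9` hosts and the scheme headline

Solo-informed seat (MatrixMultiplication), gen 102; sharpest-statement §2y(8), successor B‴.
From `binomial_twistedMatching_card_le_rpow` (the binomial count of Theorem B‴ with both tails
bounded by generating functions): if a common `0 < u ≤ 1` satisfies the LEVEL CONDITIONS
`θ_{p^m}(u) = u^{-(p^m-1)/3} Σ_{j<p^m} u^j ≤ (p^m)^c` for `1 ≤ m ≤ E`, then every twisted matching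
(arbitrary finite family of automorphism-pair twists) in a finite abelian group with `g^{p^E} = 1`
has `|ι| ≤ 3 |S|^c` (`twistedMatching_card_le_rpow_of_primePow`). Certified instances
(`theta_le_rpow_of_pow_le` reduces each level condition to one rational inequality):
* exponent `4`: `u = 5/8`, `c = 13/14 = 0.9286` (`twistedMatching_card_le_exp_four_binomial`;
  Theorem B″ gave `19/20`; the untwisted optimum for `ℤ/4^n` is `0.9262`, for `𝔽_2^n` `0.9184`);
* exponent `8`: `u = 3/4`, `c = 19/20` (`twistedMatching_card_le_exp_eight_binomial`);
* exponent `9`: `u = 3/4`, `c = 19/20` (`twistedMatching_card_le_exp_nine_binomial`; B″ gave `24/25`).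
Scheme headline (`realization_card_ge_behrend_of_rpow`, `translationScheme_card_ge_behrend_of_rpow`,
generic in the exponent; `translationScheme_exp_four_binomial`): a realization of `⟨3N,3N,3N⟩` in a
translation scheme `𝒮(S, M₀)` (Cohn–Umans 2013, Def. 11/12) over an abelian host of exponent
dividing `4`, `M₀ ≤ Aut S` ARBITRARY, forces `N² e^{-4√(log N)} ≤ 3 (|C|·|M₀|)^{13/14}`.
References: BlasiakChurchCohnGrochowNaslundSawinUmans2017 (arXiv:1605.06702) Thm. 4.14;
Petrov 2016 (arXiv:1606.02062); CohnUmans2013 (arXiv:1207.6528) Def. 11/12, Conj. 21.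
-/

noncomputable section

open scoped BigOperators
open Finset

namespace Summit.MatrixMultiplication.MatrixMultiplication.Theorems.TwistedSliceRank

section BinomialConstants

/-- Certificate reduction: `u^{-(q-1)/3} s ≤ Q^c` follows from the rational inequality
`u^{-(q-1)k} s^{3k} ≤ Q^r` when `c · 3k = r`. [folklore] -/
theorem theta_le_rpow_of_pow_le (u s Q c : ℝ) (q k r : ℕ) (hu : 0 < u) (hQ : 0 ≤ Q) (hk : k ≠ 0) (hr : c * ((3 * k : ℕ) : ℝ) = (r : ℝ))
    (h : u⁻¹ ^ ((q - 1) * k) * s ^ (3 * k) ≤ Q ^ r) :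
    u ^ (-(((q - 1 : ℕ) : ℝ) / 3)) * s ≤ Q ^ c := by
  have hY0 : 0 ≤ Q ^ c := Real.rpow_nonneg hQ _
  refine le_of_pow_le_pow_left₀ (mul_ne_zero three_ne_zero hk) hY0 ?_
  have e1 : (u ^ (-(((q - 1 : ℕ) : ℝ) / 3)) * s) ^ (3 * k) = u⁻¹ ^ ((q - 1) * k) * s ^ (3 * k) := by
    rw [mul_pow, ← Real.rpow_natCast (u ^ _) (3 * k), ← Real.rpow_mul hu.le]
    congr 1
    rw [← Real.rpow_natCast u⁻¹, Real.inv_rpow hu.le, ← Real.rpow_neg hu.le]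
    congr 1
    push_cast
    ring
  have e2 : (Q ^ c) ^ (3 * k) = Q ^ r := by
    rw [← Real.rpow_natCast (Q ^ c) (3 * k), ← Real.rpow_mul hQ, hr, Real.rpow_natCast]
  rw [e1, e2]
  exact h

/-- **Theorem B‴ with level conditions.** If `0 < u ≤ 1` and `θ_{p^m}(u) ≤ (p^m)^c` for
`1 ≤ m ≤ E`, then every twisted matching in a finite abelian group `S` with `g^{p^E} = 1`, under any
finite family of automorphism-pair twists, has `|ι| ≤ 3 |S|^c`. [this work] -/
theorem twistedMatching_card_le_rpow_of_primePow (p : ℕ) [hp : Fact p.Prime] (E : ℕ) (u c : ℝ)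
    (hu0 : 0 < u) (hu1 : u ≤ 1)
    (hθ : ∀ m : ℕ, 1 ≤ m → m ≤ E →
      (u ^ (-(((p ^ m - 1 : ℕ) : ℝ) / 3)) * ∑ j : Fin (p ^ m), u ^ ((j : ℕ) : ℝ)) ≤
        ((p ^ m : ℕ) : ℝ) ^ c)
    (S : Type) [CommGroup S] [Fintype S] [DecidableEq S] (hexpS : ∀ g : S, g ^ p ^ E = 1)
    (σ : Type) [Fintype σ] (φ ψ : σ → S ≃* S) (ι : Type) [Fintype ι] (x y z : ι → S)
    (hmatch : ∀ i j l : ι, (∃ s : σ, x i * φ s (y j) * ψ s (z l) = 1) ↔ (i = j ∧ j = l)) :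
    (Fintype.card ι : ℝ) ≤ 3 * (Fintype.card S : ℝ) ^ c := by
  classical
  -- structure theorem: `S ≃* ∏_i ℤ/n_i`, `n_i = p^{e_i}`, `e_i ≤ E`
  obtain ⟨κ, _, nn, hn1, ⟨eS⟩⟩ := CommGroup.equiv_prod_multiplicative_zmod_of_finite S
  haveI : ∀ i, NeZero (nn i) := fun i => ⟨by have := hn1 i; omega⟩
  have hex : ∀ i, ∃ m ≤ E, nn i = p ^ m := by
    intro i
    refine (Nat.dvd_prime_pow hp.out).1 ((ZMod.natCast_eq_zero_iff _ _).1 ?_)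
    have h1 := hexpS (eS.symm (Pi.mulSingle i (Multiplicative.ofAdd (1 : ZMod (nn i)))))
    rw [← map_pow, eS.symm.map_eq_one_iff, ← Pi.mulSingle_pow, ← ofAdd_nsmul, nsmul_eq_mul,
      mul_one] at h1
    have h2 := congr_fun h1 i
    rw [Pi.mulSingle_eq_same, Pi.one_apply, ofAdd_eq_one] at h2
    exact h2
  choose e heE hne using hex
  -- the level conditions cover every coordinate (`n_i = 1` is free)
  have hθ' : ∀ (q m : ℕ), q = p ^ m → m ≤ E →
      u ^ (-(((q - 1 : ℕ) : ℝ) / 3)) * ∑ j : Fin q, u ^ ((j : ℕ) : ℝ) ≤ ((q : ℕ) : ℝ) ^ c := by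
    intro q m hq hm
    subst hq
    rcases Nat.eq_zero_or_pos m with rfl | hm1
    · rw [Fin.sum_univ_eq_sum_range (fun j => u ^ ((j : ℕ) : ℝ)) (p ^ 0), pow_zero,
        Finset.sum_range_one]
      simp
    · exact hθ m hm1 hm
  exact binomial_twistedMatching_card_le_rpow p nn e hne u c hu0 hu1
    (fun i => hθ' (nn i) (e i) (hne i) (heE i)) S eS σ φ ψ ι x y z hmatch

/-- **Exponent-`4` hosts: `|ι| ≤ 3 |S|^{13/14}`** for every twisted matching under any finite family
of automorphism-pair twists (`u = 5/8`: `θ_2(5/8) = (8/5)^{1/3}·13/8 ≤ 2^{13/14}`,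
`θ_4(5/8) = 1157/320 ≤ 4^{13/14}`). [this work] -/
theorem twistedMatching_card_le_exp_four_binomial (S : Type) [CommGroup S] [Fintype S]
    [DecidableEq S] (hexpS : ∀ g : S, g ^ 4 = 1) (σ : Type) [Fintype σ] (φ ψ : σ → S ≃* S)
    (ι : Type) [Fintype ι] (x y z : ι → S)
    (hmatch : ∀ i j l : ι, (∃ s : σ, x i * φ s (y j) * ψ s (z l) = 1) ↔ (i = j ∧ j = l)) :
    (Fintype.card ι : ℝ) ≤ 3 * (Fintype.card S : ℝ) ^ (13 / 14 : ℝ) := by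
  haveI : Fact (Nat.Prime 2) := ⟨Nat.prime_two⟩
  refine twistedMatching_card_le_rpow_of_primePow 2 2 (5 / 8) (13 / 14) (by norm_num)
    (by norm_num) ?_ S (fun g => by simpa using hexpS g) σ φ ψ ι x y z hmatch
  intro m hm1 hm2
  interval_cases m
  · refine theta_le_rpow_of_pow_le (5 / 8) _ _ (13 / 14) (2 ^ 1) 14 39 (by norm_num)
      (by positivity) (by norm_num) (by norm_num) ?_
    rw [Fin.sum_univ_eq_sum_range (fun j => (5 / 8 : ℝ) ^ ((j : ℕ) : ℝ)) (2 ^ 1)]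
    norm_num [Finset.sum_range_succ]
  · refine theta_le_rpow_of_pow_le (5 / 8) _ _ (13 / 14) (2 ^ 2) 14 39 (by norm_num)
      (by positivity) (by norm_num) (by norm_num) ?_
    rw [Fin.sum_univ_eq_sum_range (fun j => (5 / 8 : ℝ) ^ ((j : ℕ) : ℝ)) (2 ^ 2)]
    norm_num [Finset.sum_range_succ]

/-- **Exponent-`8` hosts: `|ι| ≤ 3 |S|^{19/20}`** for every twisted matching under any finite family
of automorphism-pair twists (`u = 3/4`). [this work] -/
theorem twistedMatching_card_le_exp_eight_binomial (S : Type) [CommGroup S] [Fintype S]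
    [DecidableEq S] (hexpS : ∀ g : S, g ^ 8 = 1) (σ : Type) [Fintype σ] (φ ψ : σ → S ≃* S)
    (ι : Type) [Fintype ι] (x y z : ι → S)
    (hmatch : ∀ i j l : ι, (∃ s : σ, x i * φ s (y j) * ψ s (z l) = 1) ↔ (i = j ∧ j = l)) :
    (Fintype.card ι : ℝ) ≤ 3 * (Fintype.card S : ℝ) ^ (19 / 20 : ℝ) := by
  haveI : Fact (Nat.Prime 2) := ⟨Nat.prime_two⟩
  refine twistedMatching_card_le_rpow_of_primePow 2 3 (3 / 4) (19 / 20) (by norm_num)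
    (by norm_num) ?_ S (fun g => by simpa using hexpS g) σ φ ψ ι x y z hmatch
  intro m hm1 hm2
  interval_cases m
  · refine theta_le_rpow_of_pow_le (3 / 4) _ _ (19 / 20) (2 ^ 1) 20 57 (by norm_num)
      (by positivity) (by norm_num) (by norm_num) ?_
    rw [Fin.sum_univ_eq_sum_range (fun j => (3 / 4 : ℝ) ^ ((j : ℕ) : ℝ)) (2 ^ 1)]
    norm_num [Finset.sum_range_succ]
  · refine theta_le_rpow_of_pow_le (3 / 4) _ _ (19 / 20) (2 ^ 2) 20 57 (by norm_num)
      (by positivity) (by norm_num) (by norm_num) ?_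
    rw [Fin.sum_univ_eq_sum_range (fun j => (3 / 4 : ℝ) ^ ((j : ℕ) : ℝ)) (2 ^ 2)]
    norm_num [Finset.sum_range_succ]
  · refine theta_le_rpow_of_pow_le (3 / 4) _ _ (19 / 20) (2 ^ 3) 20 57 (by norm_num)
      (by positivity) (by norm_num) (by norm_num) ?_
    rw [Fin.sum_univ_eq_sum_range (fun j => (3 / 4 : ℝ) ^ ((j : ℕ) : ℝ)) (2 ^ 3)]
    norm_num [Finset.sum_range_succ]

/-- **Exponent-`9` hosts: `|ι| ≤ 3 |S|^{19/20}`** for every twisted matching under any finite family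
of automorphism-pair twists (`u = 3/4`; Theorem B″ gave `24/25`). [this work] -/
theorem twistedMatching_card_le_exp_nine_binomial (S : Type) [CommGroup S] [Fintype S]
    [DecidableEq S] (hexpS : ∀ g : S, g ^ 9 = 1) (σ : Type) [Fintype σ] (φ ψ : σ → S ≃* S)
    (ι : Type) [Fintype ι] (x y z : ι → S)
    (hmatch : ∀ i j l : ι, (∃ s : σ, x i * φ s (y j) * ψ s (z l) = 1) ↔ (i = j ∧ j = l)) :
    (Fintype.card ι : ℝ) ≤ 3 * (Fintype.card S : ℝ) ^ (19 / 20 : ℝ) := by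
  haveI : Fact (Nat.Prime 3) := ⟨Nat.prime_three⟩
  refine twistedMatching_card_le_rpow_of_primePow 3 2 (3 / 4) (19 / 20) (by norm_num)
    (by norm_num) ?_ S (fun g => by simpa using hexpS g) σ φ ψ ι x y z hmatch
  intro m hm1 hm2
  interval_cases m
  · refine theta_le_rpow_of_pow_le (3 / 4) _ _ (19 / 20) (3 ^ 1) 20 57 (by norm_num)
      (by positivity) (by norm_num) (by norm_num) ?_
    rw [Fin.sum_univ_eq_sum_range (fun j => (3 / 4 : ℝ) ^ ((j : ℕ) : ℝ)) (3 ^ 1)]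
    norm_num [Finset.sum_range_succ]
  · refine theta_le_rpow_of_pow_le (3 / 4) _ _ (19 / 20) (3 ^ 2) 20 57 (by norm_num)
      (by positivity) (by norm_num) (by norm_num) ?_
    rw [Fin.sum_univ_eq_sum_range (fun j => (3 / 4 : ℝ) ^ ((j : ℕ) : ℝ)) (3 ^ 2)]
    norm_num [Finset.sum_range_succ]

end BinomialConstants

section BinomialHeadline

/-- **Realizations force large hosts (generic exponent).** If every twisted matching in `S` under
finitely many automorphism-pair twists has `|ι| ≤ 3 |S|^c`, then a Cohn–Umans Def. 12 realization
of `⟨3N,3N,3N⟩` by a twisted triangle predicate on `S` forces `N² e^{-4√(log N)} ≤ 3 |S|^c`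
(Behrend's 3-AP-free set → an induced matching of size `r₃(N)·N`). [this work] -/
theorem realization_card_ge_behrend_of_rpow (S : Type) [CommGroup S] [Fintype S] [DecidableEq S]
    (c : ℝ)
    (hbound : ∀ (σ : Type) [Fintype σ] (φ ψ : σ → S ≃* S) (ι : Type) [Fintype ι]
      (x y z : ι → S),
      (∀ i j l : ι, (∃ s : σ, x i * φ s (y j) * ψ s (z l) = 1) ↔ (i = j ∧ j = l)) →
      (Fintype.card ι : ℝ) ≤ 3 * (Fintype.card S : ℝ) ^ c)
    (σ : Type) [Fintype σ] (φ ψ : σ → S ≃* S) (N : ℕ)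
    (α β γ : Fin (3 * N) × Fin (3 * N) → S)
    (hreal : ∀ x y z : Fin (3 * N) × Fin (3 * N),
      (∃ s : σ, α x * φ s (β y) * ψ s (γ z) = 1) ↔ (y.1 = x.2 ∧ z = (y.2, x.1))) :
    ((N : ℝ) ^ 2 * Real.exp (-4 * Real.sqrt (Real.log N))) ≤
      3 * (Fintype.card S : ℝ) ^ c := by
  obtain ⟨t, htN, htcard, ht⟩ := rothNumberNat_spec N
  obtain ⟨a, b, c', -, hind⟩ := threeAPFree_inducedMatching ht htN
  have hmatch : ∀ i j l : ↥t × Fin N,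
      (∃ s : σ, α (a i, b i) * φ s (β (b j, c' j)) * ψ s (γ (c' l, a l)) = 1) ↔
        (i = j ∧ j = l) := by
    intro i j l
    rw [hreal (a i, b i) (b j, c' j) (c' l, a l)]
    constructor
    · rintro ⟨h1, h2⟩
      simp only [Prod.mk.injEq] at h2
      exact hind i j l h1 h2.1 h2.2
    · rintro ⟨rfl, rfl⟩
      exact ⟨rfl, rfl⟩
  have h := hbound σ φ ψ (↥t × Fin N)
    (fun i => α (a i, b i)) (fun j => β (b j, c' j)) (fun l => γ (c' l, a l)) hmatch
  have hcard : Fintype.card (↥t × Fin N) = rothNumberNat N * N := by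
    rw [Fintype.card_prod, Fintype.card_coe, htcard, Fintype.card_fin]
  rw [hcard] at h
  push_cast at h
  have hB : (N : ℝ) * Real.exp (-4 * Real.sqrt (Real.log N)) ≤ rothNumberNat N :=
    Behrend.roth_lower_bound
  have hN : (0 : ℝ) ≤ N := Nat.cast_nonneg N
  calc (N : ℝ) ^ 2 * Real.exp (-4 * Real.sqrt (Real.log N))
      = ((N : ℝ) * Real.exp (-4 * Real.sqrt (Real.log N))) * N := by ring
    _ ≤ (rothNumberNat N : ℝ) * N := mul_le_mul_of_nonneg_right hB hN
    _ ≤ _ := h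

/-- **Translation schemes force large hosts (generic exponent).** If every twisted matching in `S`
has `|ι| ≤ 3 |S|^c` (`c ≥ 0`), then a realization of `⟨3N,3N,3N⟩` in the translation scheme
`𝒮(S, M₀)` (Cohn–Umans 2013 Def. 11/12; `c : S → C` an `M₀`-orbit labelling, `M₀ ≤ Aut S`
arbitrary) forces `N² e^{-4√(log N)} ≤ 3 (|C|·|M₀|)^c`. [this work] -/
theorem translationScheme_card_ge_behrend_of_rpow (S : Type) [CommGroup S] [Fintype S]
    [DecidableEq S] (r : ℝ) (hr : 0 ≤ r)
    (hbound : ∀ (σ : Type) [Fintype σ] (φ ψ : σ → S ≃* S) (ι : Type) [Fintype ι]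
      (x y z : ι → S),
      (∀ i j l : ι, (∃ s : σ, x i * φ s (y j) * ψ s (z l) = 1) ↔ (i = j ∧ j = l)) →
      (Fintype.card ι : ℝ) ≤ 3 * (Fintype.card S : ℝ) ^ r)
    (M₀ : Subgroup (MulAut S)) [Fintype M₀] (C : Type) [Fintype C] [DecidableEq C] (c : S → C)
    (hc : ∀ g h : S, c g = c h ↔ ∃ φ : M₀, (φ : MulAut S) g = h) (N : ℕ)
    (A B Γ : Fin (3 * N) × Fin (3 * N) → C)
    (hreal : ∀ x y z : Fin (3 * N) × Fin (3 * N),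
      (∃ g h l : S, c g = A x ∧ c h = B y ∧ c l = Γ z ∧ g * h * l = 1) ↔
        (y.1 = x.2 ∧ z = (y.2, x.1))) :
    ((N : ℝ) ^ 2 * Real.exp (-4 * Real.sqrt (Real.log N))) ≤
      3 * ((Fintype.card C : ℝ) * Fintype.card M₀) ^ r := by
  have hSC : (Fintype.card S : ℝ) ≤ (Fintype.card C : ℝ) * Fintype.card M₀ := by
    exact_mod_cast card_le_card_labels_mul M₀ c hc
  have hmono : 3 * (Fintype.card S : ℝ) ^ r ≤ 3 * ((Fintype.card C : ℝ) * Fintype.card M₀) ^ r := by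
    gcongr
  refine le_trans ?_ hmono
  rcases Nat.eq_zero_or_pos N with hN | hN
  · subst hN
    simp only [Nat.cast_zero, ne_eq, OfNat.ofNat_ne_zero, not_false_eq_true, zero_pow, zero_mul]
    positivity
  have w : Fin (3 * N) := ⟨0, by omega⟩
  have hA : ∀ x, ∃ g : S, c g = A x := fun x => by
    obtain ⟨g, h, l, hg, -, -, -⟩ := (hreal x (x.2, w) (w, x.1)).2 ⟨rfl, rfl⟩
    exact ⟨g, hg⟩
  have hB : ∀ y, ∃ g : S, c g = B y := fun y => by
    obtain ⟨g, h, l, -, hh, -, -⟩ := (hreal (w, y.1) y (y.2, w)).2 ⟨rfl, rfl⟩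
    exact ⟨h, hh⟩
  have hΓ : ∀ z, ∃ g : S, c g = Γ z := fun z => by
    obtain ⟨g, h, l, -, -, hl, -⟩ := (hreal (z.2, w) (w, z.1) z).2 ⟨rfl, Prod.ext rfl rfl⟩
    exact ⟨l, hl⟩
  choose α hα using hA
  choose β hβ using hB
  choose γ hγ using hΓ
  refine realization_card_ge_behrend_of_rpow S r hbound (↥M₀ × ↥M₀)
    (fun s => (s.1 : MulAut S)) (fun s => (s.2 : MulAut S)) N α β γ (fun x y z => ?_)
  rw [← hreal x y z]
  exact (triangle_iff_twisted M₀ c hc (hα x) (hβ y) (hγ z)).symm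

/-- **Exponent-`4` hosts, translation-scheme form (Theorem B‴ headline).** A realization of
`⟨3N,3N,3N⟩` in `𝒮(S, M₀)` (CU13 Def. 11/12), `S` abelian of exponent dividing `4`, `M₀ ≤ Aut S`
arbitrary, forces `N² e^{-4√(log N)} ≤ 3 (|C|·|M₀|)^{13/14}`; so rank·`|M₀| ≥ n^{28/13 - o(1)}
`= n^{2.15-o(1)}` along translation schemes over exponent-`4` hosts. [this work] -/
theorem translationScheme_exp_four_binomial (S : Type) [CommGroup S] [Fintype S]
    [DecidableEq S] (hexpS : ∀ g : S, g ^ 4 = 1) (M₀ : Subgroup (MulAut S)) [Fintype M₀]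
    (C : Type) [Fintype C] [DecidableEq C] (c : S → C)
    (hc : ∀ g h : S, c g = c h ↔ ∃ φ : M₀, (φ : MulAut S) g = h) (N : ℕ)
    (A B Γ : Fin (3 * N) × Fin (3 * N) → C)
    (hreal : ∀ x y z : Fin (3 * N) × Fin (3 * N),
      (∃ g h l : S, c g = A x ∧ c h = B y ∧ c l = Γ z ∧ g * h * l = 1) ↔
        (y.1 = x.2 ∧ z = (y.2, x.1))) :
    ((N : ℝ) ^ 2 * Real.exp (-4 * Real.sqrt (Real.log N))) ≤
      3 * ((Fintype.card C : ℝ) * Fintype.card M₀) ^ (13 / 14 : ℝ) :=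
  translationScheme_card_ge_behrend_of_rpow S (13 / 14) (by norm_num)
    (fun σ _ φ ψ ι _ x y z hmatch =>
      twistedMatching_card_le_exp_four_binomial S hexpS σ φ ψ ι x y z hmatch)
    M₀ C c hc N A B Γ hreal

end BinomialHeadline

end Summit.MatrixMultiplication.MatrixMultiplication.Theorems.TwistedSliceRank
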